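/-
Copyright (c) 2026 the pub-hodgecm-mathlib formalisation cell (harness21).  Prover seat hodgecm-mathlib-K2E3-p23 (g6), HCML Track B «K2-LIT» ∕ h413
(`stmt-HodgeConjecture-24833`), line `K2_E3_EllipticInputs`, road «GL₂-sc» (road owner K2E5-p17 (g5), dealer K2E3-plan (g4)), NON-ELLIPTIC half, brick 2N-0b, FILE 1 OF 2:
the `Fin 2` twin of ★ B4-1d `K2E3GL3ModUniformizerCentralizerTrichotomy` + `K2E3GL3ModUniformizerCentralizerCompact` (K2E3-p03 (g4)) — the DICHOTOMY
«irreducible ∨ two distinct rational eigenvalues» of a separable quadratic characteristic polynomial and the compactness criterion for `Z_{G'}(ḡ)`,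
`G' = GL₂(F) ⧸ ϖ^ℤ·1`.  2026-09-04.
-/
import Summits.HodgeConjecture.HodgeConjecture.Theorems.K2E3GL3ModUniformizerCentralizerCompact   -- ★ B4-1d (K2E3-p03 g4): generic `exists_eq_sum_smul_pow_of_irreducible`, `isUnit_sum_smul_pow_of_irreducible`, `sum_mul_smul_pow`, `sum_smul_pow_mul_comm`, `exists_zpow_mul_mem_shell`, `discr_ne_zero_of_separable`; brings ★ file 1 `irreducible_charpoly_two_iff_card_roots_eq_zero`, `derivative_eval_ne_zero_of_separable` and ★ `K2E3CharpolyRootsPerturbation.separable_of_discr_ne_zero`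
import Summits.HodgeConjecture.HodgeConjecture.Theorems.K2E3GL2ModCocompactCentral                -- ★ (2F-b) p858773 (K2E5-p17 g5): `map_scalar_le_comap_center`, `quotMap_mk`, `continuous_quotMap`; brings ★ (2F-a) `K2E3GL2ModCentre.exists_bound_of_isCompact_image` and ★ `zpowDiagGL`
import HarnessLib

/-!
# Road «GL₂-sc», non-elliptic half, brick 2N-0b — the separable-quadratic DICHOTOMY, `Z_{G'}(ḡ) = Z_{GL₂}(g)·ϖ^ℤ ∕ ϖ^ℤ`, and the compactness criterion

Cell `pub/hodgecm-mathlib` (D-0151), Track B «K2-LIT», crux H413 = `stmt-HodgeConjecture-24833`, route of record `HCCMUnconditional`.  Lane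
`--supports stmt-HodgeConjecture-24833 --as helper`; THEOREMS ONLY (no `def`, no `instance`, no `notation`, no named-fact hypothesis, no `sorry`); count-neutral.
This is the `Fin 2` reading of ★ B4-1d files 1–2 (K2E3-p03 (g4), road «GL-[M6]-sc»): the case split from which every non-elliptic brick 2N-1…2N-7 starts.
At `N = 2` the trichotomy degenerates to a DICHOTOMY — a quadratic has `0` or `2` roots counted with multiplicity, never `1`; there is no mixed (Levi-block) case.

§1 (any field `K`), `X : Matrix (Fin 2) (Fin 2) K`:
* `card_roots_ne_one_of_natDegree_eq_two`, **`card_roots_charpoly_two_eq_zero_or_two`** — `#roots χ_X ∈ {0, 2}`;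
* **`exists_conj_diagonal_of_card_roots_eq_two`** — `χ_X` with two rational roots and non-zero discriminant ⇒ `X = g · diag d · g⁻¹`, `d` injective (eigenvectors
  for distinct eigenvalues, as in ★ J0 `exists_conj_diagonal_of_card_roots_eq_three`); `card_roots_charpoly_conj_diagonal`.
§2 (any field `F`, `Λ₀ ≤ F^×`, `G_Λ := GL₂(F) ⧸ Λ₀·1`): **`centralizer_mk_eq_map_of_forall_sq_eq_one`** — if `Λ₀` has no element of order `2` then
`Z_{G_Λ}(ḡ) = Z_{GL₂(F)}(g)·Λ₀ ∕ Λ₀` (a commutator `y g y⁻¹ g⁻¹ = c·1`, `c ∈ Λ₀`, has determinant `c² = 1`); `eq_one_of_mem_zpowers_of_sq_eq_one` (`ϖ^{2n} = 1 ⇒ n = 0`),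
**`mk_mem_centralizer_mk_iff`** — for `Λ₀ = ϖ^ℤ`: `mk y ∈ Z_{G'}(mk g) ↔ y g = g y`.
§3 (`F` non-archimedean local, `Valued F ℤᵐ⁰` frame of ★ (2F-a)∕(2F-b); `G' := GL₂(F) ⧸ ϖ^ℤ·1`):
* **`not_isCompact_centralizer_mk_of_card_roots_eq_two`** — two rational eigenvalues ⇒ `Z_{G'}(ḡ)` NOT compact (`g = h·diag d·h⁻¹`; the elements
  `h · diag(1, ϖ^k) · h⁻¹` centralise `g` and violate ★ (2F-a) `exists_bound_of_isCompact_image` in `Ḡ = GL₂(F) ⧸ Z`);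
  `not_isCompact_centralizer_mk_of_card_roots_eq_two`, `not_isCompact_centralizer_mk_of_not_irreducible`.
File 2 (`K2E3GL2ModUniformizerCentralizerCompact`) proves the converse (irreducible `χ_g` ⇒ `Z_{G'}(ḡ)` compact) and assembles the `iff` and its normal-form
restatement `not_isCompact_centralizer_mk_iff`.
[HarishChandra1970, Part VII §3 (compactness of `T∕Z` for elliptic tori); Cartier1979, §I.3–I.4; PlatonovRapinchuk1994, §3.3]
HONEST LABEL: HC_CM is proved only modulo the 7 printed citations (2 remaining named inputs: hLiu418 = stmt-HodgeConjecture-24832, h413 =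
stmt-HodgeConjecture-24833) until rung 0 closes; count-neutral helper.

## References
* [HarishChandra1970] Harish-Chandra (notes by G. van Dijk), *Harmonic Analysis on Reductive p-adic Groups*, LNM 162 (1970), Part VII §3.
* [Cartier1979] P. Cartier, *Representations of p-adic groups: a survey*, Corvallis (1979), §I.3–I.4.
* [PlatonovRapinchuk1994] V. Platonov, A. Rapinchuk, *Algebraic Groups and Number Theory* (1994), §3.3.
-/

set_option autoImplicit false
set_option linter.dupNamespace false   -- `Summit.HodgeConjecture.HodgeConjecture.…` (D-0017 nested layout; lakefile exemption for Summits)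

noncomputable section

open Polynomial Topology
open scoped Matrix MatrixGroups WithZero
open Literature.NumberTheory.Automorphic
open Summit.HodgeConjecture.HodgeConjecture.Cruxes.H413.K2E3CharpolyRootsPerturbation (separable_of_discr_ne_zero)
open Summit.HodgeConjecture.HodgeConjecture.Cruxes.H413.K2E3GL3ModUniformizerCentralizerTrichotomy
  (irreducible_charpoly_two_iff_card_roots_eq_zero derivative_eval_ne_zero_of_separable)
open Summit.HodgeConjecture.HodgeConjecture.Cruxes.H413.K2E3GL3ModUniformizerCentralizerCompact
  (exists_eq_sum_smul_pow_of_irreducible isUnit_sum_smul_pow_of_irreducible sum_mul_smul_pow sum_smul_pow_mul_comm exists_zpow_mul_mem_shell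
    discr_ne_zero_of_separable)
open Summit.HodgeConjecture.HodgeConjecture.Cruxes.H413.K2E3GL2ModCentre
open Summit.HodgeConjecture.HodgeConjecture.Cruxes.H413.K2E3GL2ModCocompactCentral

namespace Summit.HodgeConjecture.HodgeConjecture.Cruxes.H413.K2E3GL2ModUniformizerCentralizerDichotomy

/-! ## §1  The dichotomy of a quadratic characteristic polynomial, in normal-form currency -/

section Dichotomy

variable {K : Type*} [Field K]

/-- A polynomial of degree `2` never has exactly one root counted with multiplicity (the cofactor of `X − a` is linear). [folklore] -/
theorem card_roots_ne_one_of_natDegree_eq_two {f : K[X]} (hdeg : f.natDegree = 2) : f.roots.card ≠ 1 := by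
  intro h1
  obtain ⟨q, hprod, hcard, hq⟩ := exists_prod_multiset_X_sub_C_mul f
  rw [h1, hdeg] at hcard
  have hq1 : q.natDegree = 1 := by omega
  have hq0 : q ≠ 0 := by
    intro h0
    rw [h0, natDegree_zero] at hq1
    exact zero_ne_one hq1
  obtain ⟨x, hx⟩ := exists_root_of_degree_eq_one ((degree_eq_iff_natDegree_eq hq0).2 hq1)
  have hmem : x ∈ q.roots := (mem_roots hq0).2 hx
  rw [hq] at hmem
  exact Multiset.notMem_zero x hmem

/-- **`#roots χ_X ∈ {0, 2}`** for every `2 × 2` matrix `X` (roots in `K`, counted with multiplicity). [folklore] -/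
theorem card_roots_charpoly_two_eq_zero_or_two (X : Matrix (Fin 2) (Fin 2) K) :
    X.charpoly.roots.card = 0 ∨ X.charpoly.roots.card = 2 := by
  have hdeg : X.charpoly.natDegree = 2 := by rw [Matrix.charpoly_natDegree_eq_dim, Fintype.card_fin]
  have hle : X.charpoly.roots.card ≤ 2 := by
    have h := Polynomial.card_roots' X.charpoly
    rwa [hdeg] at h
  have hne : X.charpoly.roots.card ≠ 1 := card_roots_ne_one_of_natDegree_eq_two hdeg
  omega

/-- **Split regular semisimple ⇒ diagonalisable over `K`** (`2 × 2`).  If `χ_X` has two rational roots and non-zero discriminant, then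
`X = g · diagonal d · g⁻¹` for some `g ∈ GL₂(K)` and an injective `d : Fin 2 → K` (eigenvectors for distinct eigenvalues are linearly independent, Mathlib
`Module.End.eigenvectors_linearIndependent'`, and form the columns of `g`). [folklore; cite: PlatonovRapinchuk1994, §3.3] -/
theorem exists_conj_diagonal_of_card_roots_eq_two (X : Matrix (Fin 2) (Fin 2) K) (h2 : X.charpoly.roots.card = 2) (hD : X.charpoly.discr ≠ 0) :
    ∃ (g : GL (Fin 2) K) (d : Fin 2 → K), Function.Injective d ∧
      X = (g : Matrix (Fin 2) (Fin 2) K) * Matrix.diagonal d * ((g⁻¹ : GL (Fin 2) K) : Matrix (Fin 2) (Fin 2) K) := by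
  classical
  have hmon : X.charpoly.Monic := Matrix.charpoly_monic X
  have hdeg : X.charpoly.natDegree = 2 := by rw [Matrix.charpoly_natDegree_eq_dim, Fintype.card_fin]
  have hχ0 : X.charpoly ≠ 0 := hmon.ne_zero
  have hsep : X.charpoly.Separable := separable_of_discr_ne_zero hmon (by omega) hD
  obtain ⟨x₁, x₂, hT⟩ := Multiset.card_eq_two.1 h2
  have hne : x₁ ≠ x₂ := by
    have h := nodup_roots hsep
    rw [hT] at h
    simp only [Multiset.insert_eq_cons, Multiset.nodup_cons, Multiset.mem_singleton, Multiset.nodup_singleton, and_true] at h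
    exact h
  -- the two eigenvalues
  set d : Fin 2 → K := ![x₁, x₂] with hd
  have hdinj : Function.Injective d := by
    intro i j hij
    fin_cases i <;> fin_cases j <;> simp [hd] at hij ⊢ <;>
      first
      | exact absurd hij hne
      | exact absurd hij.symm hne
  have hroot : ∀ i, X.charpoly.IsRoot (d i) := by
    intro i
    rw [← mem_roots hχ0, hT]
    fin_cases i <;> simp [hd]
  -- eigenvectors
  have heig : ∀ i, ∃ v : Fin 2 → K, v ≠ 0 ∧ X *ᵥ v = d i • v := by
    intro i
    have hdet : (Matrix.scalar (Fin 2) (d i) - X).det = 0 := by rw [← Matrix.eval_charpoly]; exact hroot i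
    obtain ⟨v, hv0, hv⟩ := Matrix.exists_mulVec_eq_zero_iff.2 hdet
    refine ⟨v, hv0, ?_⟩
    rw [Matrix.sub_mulVec, sub_eq_zero] at hv
    rw [← hv]
    ext j
    simp [Matrix.scalar_apply, Matrix.mulVec_diagonal]
  choose v hv0 hv using heig
  have hli : LinearIndependent K v := by
    refine Module.End.eigenvectors_linearIndependent' (Matrix.toLin' X) d hdinj v fun i => ?_
    exact ⟨Module.End.mem_eigenspace_iff.2 (by rw [Matrix.toLin'_apply, hv i]), hv0 i⟩
  -- the matrix of eigenvectors (columns `v j`)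
  set P : Matrix (Fin 2) (Fin 2) K := (Matrix.of v)ᵀ with hP
  have hPu : IsUnit P := by
    rw [← Matrix.linearIndependent_cols_iff_isUnit, hP, Matrix.col_transpose]
    exact hli
  have hXP : X * P = P * Matrix.diagonal d := by
    ext i j
    have hij : (X *ᵥ v j) i = d j * v j i := by rw [hv j]; simp
    calc (X * P) i j = (X *ᵥ v j) i := by simp [hP, Matrix.mul_apply, Matrix.mulVec, dotProduct]
      _ = d j * v j i := hij
      _ = (P * Matrix.diagonal d) i j := by rw [Matrix.mul_diagonal]; simp [hP, mul_comm]
  refine ⟨hPu.unit, d, hdinj, ?_⟩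
  have hPinv : P * ((hPu.unit⁻¹ : GL (Fin 2) K) : Matrix (Fin 2) (Fin 2) K) = 1 := by
    have h := hPu.unit.mul_inv
    rwa [IsUnit.unit_spec] at h
  calc X = X * (P * ((hPu.unit⁻¹ : GL (Fin 2) K) : Matrix (Fin 2) (Fin 2) K)) := by rw [hPinv, mul_one]
    _ = X * P * ((hPu.unit⁻¹ : GL (Fin 2) K) : Matrix (Fin 2) (Fin 2) K) := by rw [mul_assoc]
    _ = P * Matrix.diagonal d * ((hPu.unit⁻¹ : GL (Fin 2) K) : Matrix (Fin 2) (Fin 2) K) := by rw [hXP]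
    _ = (hPu.unit : Matrix (Fin 2) (Fin 2) K) * Matrix.diagonal d * ((hPu.unit⁻¹ : GL (Fin 2) K) : Matrix (Fin 2) (Fin 2) K) := by
        rw [IsUnit.unit_spec]

/-- A conjugate of a `2 × 2` diagonal matrix has exactly two roots (counted with multiplicity). [folklore] -/
theorem card_roots_charpoly_conj_diagonal (g : GL (Fin 2) K) {d : Fin 2 → K} :
    ((g : Matrix (Fin 2) (Fin 2) K) * Matrix.diagonal d * ((g⁻¹ : GL (Fin 2) K) : Matrix (Fin 2) (Fin 2) K)).charpoly.roots.card = 2 := by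
  rw [Matrix.coe_units_inv, Matrix.charpoly_units_conj, Matrix.charpoly_diagonal, Polynomial.roots_prod _ _ ?_]
  · rw [Multiset.card_bind]
    simp
  · exact Finset.prod_ne_zero_iff.2 fun i _ => Polynomial.X_sub_C_ne_zero (d i)

/-- `diag(s, t)` commutes with every diagonal matrix. [folklore] -/
theorem diagonal_mul_diagonal_comm (d e : Fin 2 → K) :
    Matrix.diagonal d * Matrix.diagonal e = Matrix.diagonal e * Matrix.diagonal d := by
  rw [Matrix.diagonal_mul_diagonal, Matrix.diagonal_mul_diagonal]
  congr 1
  funext i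
  exact mul_comm _ _

end Dichotomy

/-! ## §2  `Z_{G_Λ}(ḡ)` is the image of `Z_{GL₂(F)}(g)` when `Λ₀` has no element of order two — in particular for `Λ₀ = ϖ^ℤ` -/

section Key

variable {F : Type*} [Field F]

/-- **`Z_{G_Λ}(ḡ) = Z_{GL₂(F)}(g)·Λ₀ ∕ Λ₀`** whenever `c ∈ Λ₀, c² = 1 ⇒ c = 1`: if `ȳ` commutes with `ḡ` then `g y = y g (c·1)` with `c ∈ Λ₀`, and determinants give
`c² = 1`. [cite: PlatonovRapinchuk1994, §3.3] -/
theorem centralizer_mk_eq_map_of_forall_sq_eq_one (Λ₀ : Subgroup Fˣ) [(Λ₀.map (Matrix.GeneralLinearGroup.scalar (Fin 2))).Normal]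
    (hΛ : ∀ c ∈ Λ₀, c ^ 2 = 1 → c = 1) (g : GL (Fin 2) F) :
    Subgroup.centralizer {(QuotientGroup.mk g : GL (Fin 2) F ⧸ Λ₀.map (Matrix.GeneralLinearGroup.scalar (Fin 2)))} =
      (Subgroup.centralizer {g}).map (QuotientGroup.mk' (Λ₀.map (Matrix.GeneralLinearGroup.scalar (Fin 2)))) := by
  ext x
  constructor
  · intro hx
    obtain ⟨y, rfl⟩ := QuotientGroup.mk_surjective x
    refine Subgroup.mem_map.2 ⟨y, ?_, rfl⟩
    rw [Subgroup.mem_centralizer_singleton_iff] at hx ⊢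
    have hcomm : (QuotientGroup.mk (y * g) : GL (Fin 2) F ⧸ Λ₀.map (Matrix.GeneralLinearGroup.scalar (Fin 2))) = QuotientGroup.mk (g * y) := by
      rw [QuotientGroup.mk_mul, QuotientGroup.mk_mul]
      exact hx
    rw [QuotientGroup.eq] at hcomm
    obtain ⟨c, hc, hs⟩ := Subgroup.mem_map.1 hcomm
    have hgy : g * y = y * g * Matrix.GeneralLinearGroup.scalar (Fin 2) c := by
      rw [hs, mul_inv_cancel_left]
    -- determinants: `c² = 1`
    have hc2 : c ^ 2 = 1 := by
      have h := congrArg Matrix.GeneralLinearGroup.det hgy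
      rw [map_mul, map_mul, map_mul, Matrix.GeneralLinearGroup.det_scalar, Fintype.card_fin,
        mul_comm (Matrix.GeneralLinearGroup.det g)] at h
      exact left_eq_mul.1 h
    rw [hΛ c hc hc2, map_one, mul_one] at hgy
    exact hgy.symm
  · intro hx
    obtain ⟨y, hy, rfl⟩ := Subgroup.mem_map.1 hx
    rw [Subgroup.mem_centralizer_singleton_iff] at hy ⊢
    change (QuotientGroup.mk y : GL (Fin 2) F ⧸ Λ₀.map (Matrix.GeneralLinearGroup.scalar (Fin 2))) * QuotientGroup.mk g =
      QuotientGroup.mk g * QuotientGroup.mk y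
    rw [← QuotientGroup.mk_mul, ← QuotientGroup.mk_mul, hy]

/-- Under the same hypothesis: **`mk y ∈ Z_{G_Λ}(mk g) ↔ y g = g y`** (the scalars `Λ₀·1` are central). [cite: PlatonovRapinchuk1994, §3.3] -/
theorem mk_mem_centralizer_mk_iff_of_forall_sq_eq_one (Λ₀ : Subgroup Fˣ) [(Λ₀.map (Matrix.GeneralLinearGroup.scalar (Fin 2))).Normal]
    (hΛ : ∀ c ∈ Λ₀, c ^ 2 = 1 → c = 1) (g y : GL (Fin 2) F) :
    (QuotientGroup.mk y : GL (Fin 2) F ⧸ Λ₀.map (Matrix.GeneralLinearGroup.scalar (Fin 2))) ∈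
        Subgroup.centralizer {(QuotientGroup.mk g : GL (Fin 2) F ⧸ Λ₀.map (Matrix.GeneralLinearGroup.scalar (Fin 2)))} ↔ y * g = g * y := by
  rw [centralizer_mk_eq_map_of_forall_sq_eq_one Λ₀ hΛ g]
  constructor
  · intro h
    obtain ⟨y', hy', hyy'⟩ := Subgroup.mem_map.1 h
    change (QuotientGroup.mk y' : GL (Fin 2) F ⧸ Λ₀.map (Matrix.GeneralLinearGroup.scalar (Fin 2))) = QuotientGroup.mk y at hyy'
    rw [QuotientGroup.eq] at hyy'
    obtain ⟨c, -, hs⟩ := Subgroup.mem_map.1 hyy'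
    have hy : y = y' * Matrix.GeneralLinearGroup.scalar (Fin 2) c := by rw [hs, mul_inv_cancel_left]
    rw [Subgroup.mem_centralizer_singleton_iff] at hy'
    calc y * g = y' * (g * Matrix.GeneralLinearGroup.scalar (Fin 2) c) := by rw [hy, mul_assoc, Matrix.GeneralLinearGroup.scalar_commute]
      _ = g * y := by rw [← mul_assoc, hy', mul_assoc, ← hy]
  · intro h
    exact Subgroup.mem_map.2 ⟨y, Subgroup.mem_centralizer_singleton_iff.2 h, rfl⟩

variable [Valued F ℤᵐ⁰]

/-- `ϖ^ℤ` contains no element of order two (`v(ϖ) = exp(−1)`, so `ϖ^{2n} = 1` forces `n = 0`). [folklore] -/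
theorem eq_one_of_mem_zpowers_of_sq_eq_one {ϖ : F} (hϖ : Valued.v ϖ = WithZero.exp (-1 : ℤ)) (hϖ0 : ϖ ≠ 0)
    (c : Fˣ) (hc : c ∈ Subgroup.zpowers (Units.mk0 ϖ hϖ0)) (hc2 : c ^ 2 = 1) : c = 1 := by
  obtain ⟨k, rfl⟩ := Subgroup.mem_zpowers_iff.1 hc
  have hv : Valued.v ((((Units.mk0 ϖ hϖ0 ^ k) ^ 2 : Fˣ) : F)) = 1 := by rw [hc2, Units.val_one, map_one]
  rw [Units.val_pow_eq_pow_val, Units.val_zpow_eq_zpow_val, Units.val_mk0, map_pow, map_zpow₀, hϖ, ← WithZero.exp_zsmul, ← WithZero.exp_nsmul,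
    WithZero.exp_eq_one, smul_eq_mul, nsmul_eq_mul] at hv
  have hk : k = 0 := by push_cast at hv; omega
  rw [hk, zpow_zero]

/-- **`Z_{G'}(ḡ) = Z_{GL₂(F)}(g)·ϖ^ℤ ∕ ϖ^ℤ`** for `G' = GL₂(F) ⧸ ϖ^ℤ·1`: there are no twisted cosets modulo `ϖ^ℤ`. [cite: PlatonovRapinchuk1994, §3.3] -/
theorem centralizer_mk_eq_map {ϖ : F} (hϖ : Valued.v ϖ = WithZero.exp (-1 : ℤ)) (hϖ0 : ϖ ≠ 0)
    [((Subgroup.zpowers (Units.mk0 ϖ hϖ0)).map (Matrix.GeneralLinearGroup.scalar (Fin 2))).Normal] (g : GL (Fin 2) F) :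
    Subgroup.centralizer {(QuotientGroup.mk g : GL (Fin 2) F ⧸ (Subgroup.zpowers (Units.mk0 ϖ hϖ0)).map (Matrix.GeneralLinearGroup.scalar (Fin 2)))} =
      (Subgroup.centralizer {g}).map (QuotientGroup.mk' ((Subgroup.zpowers (Units.mk0 ϖ hϖ0)).map (Matrix.GeneralLinearGroup.scalar (Fin 2)))) :=
  centralizer_mk_eq_map_of_forall_sq_eq_one _ (fun c hc hc2 => eq_one_of_mem_zpowers_of_sq_eq_one hϖ hϖ0 c hc hc2) g

/-- **`mk y ∈ Z_{G'}(mk g) ↔ y g = g y`** for `G' = GL₂(F) ⧸ ϖ^ℤ·1`. [cite: PlatonovRapinchuk1994, §3.3] -/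
theorem mk_mem_centralizer_mk_iff {ϖ : F} (hϖ : Valued.v ϖ = WithZero.exp (-1 : ℤ)) (hϖ0 : ϖ ≠ 0)
    [((Subgroup.zpowers (Units.mk0 ϖ hϖ0)).map (Matrix.GeneralLinearGroup.scalar (Fin 2))).Normal] (g y : GL (Fin 2) F) :
    (QuotientGroup.mk y : GL (Fin 2) F ⧸ (Subgroup.zpowers (Units.mk0 ϖ hϖ0)).map (Matrix.GeneralLinearGroup.scalar (Fin 2))) ∈
        Subgroup.centralizer {(QuotientGroup.mk g : GL (Fin 2) F ⧸ (Subgroup.zpowers (Units.mk0 ϖ hϖ0)).map (Matrix.GeneralLinearGroup.scalar (Fin 2)))} ↔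
      y * g = g * y :=
  mk_mem_centralizer_mk_iff_of_forall_sq_eq_one _ (fun c hc hc2 => eq_one_of_mem_zpowers_of_sq_eq_one hϖ hϖ0 c hc hc2) g y

end Key

/-! ## §3  Two rational eigenvalues ⇒ `Z_{G'}(ḡ)` non-compact; `χ_g` irreducible ⇒ compact; the criterion -/

section NotCompact

variable {F : Type*} [Field F] [Valued F ℤᵐ⁰] [ValuativeRel F] [IsNonarchimedeanLocalField F]

/-- **Two rational eigenvalues make the centraliser non-compact modulo `ϖ^ℤ`.**  If `g = h · diag d · h⁻¹` then `Z_{G'}(ḡ) ⊆ G' = GL₂(F) ⧸ ϖ^ℤ·1` is not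
compact: it contains the images of `h · diag(1, ϖ^k) · h⁻¹`, whose images in `Ḡ = GL₂(F) ∕ Z` violate the scale-invariant entry bound ★ (2F-a)
`exists_bound_of_isCompact_image` of any compact set. [cite: HarishChandra1970, Part VII §3; cite: Cartier1979, §I.3] -/
theorem not_isCompact_centralizer_mk_of_coe_eq_conj_diagonal {ϖ : F} (hϖ : Valued.v ϖ = WithZero.exp (-1 : ℤ)) (hϖ0 : ϖ ≠ 0)
    [((Subgroup.zpowers (Units.mk0 ϖ hϖ0)).map (Matrix.GeneralLinearGroup.scalar (Fin 2))).Normal]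
    (g h : GL (Fin 2) F) (d : Fin 2 → F)
    (hX : (g : Matrix (Fin 2) (Fin 2) F) = (h : Matrix (Fin 2) (Fin 2) F) * Matrix.diagonal d * ((h⁻¹ : GL (Fin 2) F) : Matrix (Fin 2) (Fin 2) F)) :
    ¬ IsCompact ((Subgroup.centralizer {(QuotientGroup.mk g : GL (Fin 2) F ⧸ (Subgroup.zpowers (Units.mk0 ϖ hϖ0)).map (Matrix.GeneralLinearGroup.scalar (Fin 2)))} :
      Subgroup (GL (Fin 2) F ⧸ (Subgroup.zpowers (Units.mk0 ϖ hϖ0)).map (Matrix.GeneralLinearGroup.scalar (Fin 2)))) :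
        Set (GL (Fin 2) F ⧸ (Subgroup.zpowers (Units.mk0 ϖ hϖ0)).map (Matrix.GeneralLinearGroup.scalar (Fin 2)))) := by
  intro hZ
  have hle := map_scalar_le_comap_center (F := F) (Subgroup.zpowers (Units.mk0 ϖ hϖ0))
  -- (1) the diagonal normal form `h⁻¹ g h = diag d`
  have hM : ((h⁻¹ * g * h : GL (Fin 2) F) : Matrix (Fin 2) (Fin 2) F) = Matrix.diagonal d := by
    rw [Units.val_mul, Units.val_mul, hX, ← mul_assoc, ← mul_assoc, Units.inv_mul, one_mul, mul_assoc, Units.inv_mul, mul_one]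
  -- (2) the compact set `h̄⁻¹ · q(Z_{G'}(ḡ)) · h̄ ⊆ Ḡ`
  set c : GL (Fin 2) F ⧸ Subgroup.center (GL (Fin 2) F) := QuotientGroup.mk h with hc
  set Z : Set (GL (Fin 2) F ⧸ (Subgroup.zpowers (Units.mk0 ϖ hϖ0)).map (Matrix.GeneralLinearGroup.scalar (Fin 2))) :=
    SetLike.coe (Subgroup.centralizer {(QuotientGroup.mk g : GL (Fin 2) F ⧸ (Subgroup.zpowers (Units.mk0 ϖ hϖ0)).map (Matrix.GeneralLinearGroup.scalar (Fin 2)))})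
    with hZdef
  have hXc : IsCompact ((fun x => c⁻¹ * x * c) ''
      ((QuotientGroup.map _ (Subgroup.center (GL (Fin 2) F)) (MonoidHom.id (GL (Fin 2) F)) hle) '' Z)) :=
    (hZ.image (continuous_quotMap _ hle)).image ((continuous_const.mul continuous_id).mul continuous_const)
  obtain ⟨N, hN⟩ := exists_bound_of_isCompact_image hϖ hXc
  -- (3) the torus elements `diag(1, ϖ^k)` lie in it
  have hD : ∀ k : ℤ, (QuotientGroup.mk (zpowDiagGL hϖ0 ![0, k]) : GL (Fin 2) F ⧸ Subgroup.center (GL (Fin 2) F)) ∈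
      (fun x => c⁻¹ * x * c) '' ((QuotientGroup.map _ (Subgroup.center (GL (Fin 2) F)) (MonoidHom.id (GL (Fin 2) F)) hle) '' Z) := by
    intro k
    have hDM : zpowDiagGL hϖ0 ![0, k] * (h⁻¹ * g * h) = h⁻¹ * g * h * zpowDiagGL hϖ0 ![0, k] := by
      apply Units.ext
      rw [Units.val_mul, hM, Units.val_mul, hM, coe_zpowDiagGL]
      exact diagonal_mul_diagonal_comm _ _
    have hy : h * zpowDiagGL hϖ0 ![0, k] * h⁻¹ * g = g * (h * zpowDiagGL hϖ0 ![0, k] * h⁻¹) := by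
      calc h * zpowDiagGL hϖ0 ![0, k] * h⁻¹ * g = h * (zpowDiagGL hϖ0 ![0, k] * (h⁻¹ * g * h)) * h⁻¹ := by group
        _ = h * (h⁻¹ * g * h * zpowDiagGL hϖ0 ![0, k]) * h⁻¹ := by rw [hDM]
        _ = g * (h * zpowDiagGL hϖ0 ![0, k] * h⁻¹) := by group
    refine ⟨QuotientGroup.map _ (Subgroup.center (GL (Fin 2) F)) (MonoidHom.id (GL (Fin 2) F)) hle (QuotientGroup.mk (h * zpowDiagGL hϖ0 ![0, k] * h⁻¹)),
      ⟨QuotientGroup.mk (h * zpowDiagGL hϖ0 ![0, k] * h⁻¹), ?_, rfl⟩, ?_⟩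
    · rw [hZdef]
      exact (mk_mem_centralizer_mk_iff hϖ hϖ0 g _).2 hy
    · change c⁻¹ * _ * c = _
      rw [quotMap_mk, hc, ← QuotientGroup.mk_inv, ← QuotientGroup.mk_mul, ← QuotientGroup.mk_mul]
      congr 1
      group
  -- (4) the scale-invariant bound fails at `k = 2N + 1`
  have hb := hN (zpowDiagGL hϖ0 ![0, (2 * (N : ℤ) + 1)]) (hD _) 0 0 1 1
  have e0 : (![0, (2 * (N : ℤ) + 1)] : Fin 2 → ℤ) 0 = 0 := rfl
  have e1 : (-(![0, (2 * (N : ℤ) + 1)] : Fin 2 → ℤ)) 1 = -(2 * (N : ℤ) + 1) := rfl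
  rw [← zpowDiagGL_neg, coe_zpowDiagGL, coe_zpowDiagGL, Matrix.diagonal_apply_eq, Matrix.diagonal_apply_eq, e0, e1, zpow_zero, map_one, one_mul,
    map_zpow₀, hϖ, ← WithZero.exp_zsmul, smul_eq_mul, WithZero.exp_le_exp] at hb
  omega

/-- **Two rational roots ⇒ `Z_{G'}(ḡ)` is not compact** (`χ_g` separable). [cite: HarishChandra1970, Part VII §3] -/
theorem not_isCompact_centralizer_mk_of_card_roots_eq_two [CharZero F] {ϖ : F} (hϖ : Valued.v ϖ = WithZero.exp (-1 : ℤ)) (hϖ0 : ϖ ≠ 0)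
    [((Subgroup.zpowers (Units.mk0 ϖ hϖ0)).map (Matrix.GeneralLinearGroup.scalar (Fin 2))).Normal]
    (g : GL (Fin 2) F) (hsep : (g : Matrix (Fin 2) (Fin 2) F).charpoly.Separable) (h2 : (g : Matrix (Fin 2) (Fin 2) F).charpoly.roots.card = 2) :
    ¬ IsCompact ((Subgroup.centralizer {(QuotientGroup.mk g : GL (Fin 2) F ⧸ (Subgroup.zpowers (Units.mk0 ϖ hϖ0)).map (Matrix.GeneralLinearGroup.scalar (Fin 2)))} :
      Subgroup (GL (Fin 2) F ⧸ (Subgroup.zpowers (Units.mk0 ϖ hϖ0)).map (Matrix.GeneralLinearGroup.scalar (Fin 2)))) :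
        Set (GL (Fin 2) F ⧸ (Subgroup.zpowers (Units.mk0 ϖ hϖ0)).map (Matrix.GeneralLinearGroup.scalar (Fin 2)))) := by
  obtain ⟨h, d, -, hX⟩ := exists_conj_diagonal_of_card_roots_eq_two _ h2
    (discr_ne_zero_of_separable (Matrix.charpoly_monic _) (by rw [Matrix.charpoly_natDegree_eq_dim, Fintype.card_fin]; norm_num) hsep)
  exact not_isCompact_centralizer_mk_of_coe_eq_conj_diagonal hϖ hϖ0 g h d hX

/-- **Not irreducible ⇒ not compact** (separable `χ_g`): a reducible separable quadratic has two rational roots. [cite: HarishChandra1970, Part VII §3] -/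
theorem not_isCompact_centralizer_mk_of_not_irreducible [CharZero F] {ϖ : F} (hϖ : Valued.v ϖ = WithZero.exp (-1 : ℤ)) (hϖ0 : ϖ ≠ 0)
    [((Subgroup.zpowers (Units.mk0 ϖ hϖ0)).map (Matrix.GeneralLinearGroup.scalar (Fin 2))).Normal]
    (g : GL (Fin 2) F) (hsep : (g : Matrix (Fin 2) (Fin 2) F).charpoly.Separable) (hirr : ¬ Irreducible (g : Matrix (Fin 2) (Fin 2) F).charpoly) :
    ¬ IsCompact ((Subgroup.centralizer {(QuotientGroup.mk g : GL (Fin 2) F ⧸ (Subgroup.zpowers (Units.mk0 ϖ hϖ0)).map (Matrix.GeneralLinearGroup.scalar (Fin 2)))} :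
      Subgroup (GL (Fin 2) F ⧸ (Subgroup.zpowers (Units.mk0 ϖ hϖ0)).map (Matrix.GeneralLinearGroup.scalar (Fin 2)))) :
        Set (GL (Fin 2) F ⧸ (Subgroup.zpowers (Units.mk0 ϖ hϖ0)).map (Matrix.GeneralLinearGroup.scalar (Fin 2)))) := by
  rw [irreducible_charpoly_two_iff_card_roots_eq_zero] at hirr
  rcases card_roots_charpoly_two_eq_zero_or_two (g : Matrix (Fin 2) (Fin 2) F) with h0 | h2
  · exact absurd h0 hirr
  · exact not_isCompact_centralizer_mk_of_card_roots_eq_two hϖ hϖ0 g hsep h2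

end NotCompact

end Summit.HodgeConjecture.HodgeConjecture.Cruxes.H413.K2E3GL2ModUniformizerCentralizerDichotomy

end
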